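import Summits.BirchSwinnertonDyer.BirchSwinnertonDyer.Theorems.EdixhovenFibreFiveSevenStarredOptimalManinUnitFiveSevenReciprocityGaloisDescent
import HarnessLib

/-!
# [REC-tower] at a Galois tower `F₀ ⊆ F` from Kato's formula over ANY finite extension `K' ⊇ F` with ANY constant
# (route `EdixhovenFibreFiveSeven`, crux K★ `StarredOptimalManinUnitFiveSeven` stmt-BirchSwinnertonDyer-22226, line `kato-lever`)

HONEST FRAMING. Theorems only (no definition, no named fact, no `sorry`, no instance); `--supports` 22226 (helper); nothing is
closed; BSD / K★ / [REC-tower] are NOT proved by this file. Sequel of `…ReciprocityGaloisDescent` (`exists_const_tower_clauses_of_galois`).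

WHAT. The ONE theorem a cell calls: ★★★ `exists_const_tower_clauses_of_formula_above` — the body `∃ c₀ ≠ 0, (lower clause) ∧ (upper clause)`
of [REC-tower] `tatePairingPoint_eq_trace_expStar_log_tower` at `(W, F₀ ⊆ F, e, d₀, d)` for a GALOIS extension `F/F₀` of `p`-adic fields, from
Kato's formula `⟨[η], P⟩ = Tr_{K'/ℚ_p}(c' · exp*(η) · log_ω P)` over a further finite extension `K' ⊇ F` (the field of good reduction of the cell,
`K' = K_v(μ_m)_{w'}` over `F = ℚ_p(μ_m)_{w₀}` over `F₀ = ℚ_p`) for the DIRECT representation `T_pW|_{Γ_{K'}}` with an ARBITRARY constant `c' ∈ K'`: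
DESCENT `K' → F` (`ReciprocityLawTowerAssembly.tatePairingPoint_eq_trace_of_direct_towerConj`, LEAD g22; constant `[K':F]⁻¹ Tr_{K'/F}(c')`) followed
by GALOIS AVERAGING over `Gal(F/F₀)` (`exists_const_tower_clauses_of_galois`, g23). Remaining inputs: the Prop-1.2.3 binders of the two tower
representations (over `F` relative to `F₀`, over `K'` relative to `F`), the compatibility clauses `hcomp` (`d₀ ↔ d`) and `hcomp'` (`d.map V(γ⁻¹) ↔ d'`),
the functorialities `hlog`, `hlog'` of `log_ω`, non-degeneracy of the Weil tower, a nonzero additive `E(F₀) → ℤ_p`.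

So [REC-tower]@cell ⟸ (K₂)@K' (∘ G1 transport, ✓ `TatePairingPointOfKTwoTransport`) + cell plumbing. K★ stays OPEN ⟸ {P1-bar, (K₂)}.

## References
* K. Kato, LNM 1553 (1993), Ch. II §1.2.4, Thm. 1.4.1 (4). [Kato1993LNM1553]
* J.-P. Serre, *Local Fields* (1979), XIII §3 Prop. 7. [SerreLocalFields1979]
-/

set_option autoImplicit false
-- the Theorems namespace of a single-conjunct summit repeats the summit name by design (D-0017)
set_option linter.dupNamespace false

noncomputable section

open scoped Classical NNReal TensorProduct
open CategoryTheory Function Field ValuativeRel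
open Literature.NumberTheory.GaloisRepresentations
open Literature.NumberTheory.GaloisRepresentations.IsNonarchimedeanLocalField
open Literature.NumberTheory.PAdicHodge
open Literature.NumberTheory.EllipticCurves _root_.WeierstrassCurve
open Summit.BirchSwinnertonDyer.BirchSwinnertonDyer.Theorems.StarredOptimalManinUnitFiveSevenReciprocityGaloisDescent

namespace Summit.BirchSwinnertonDyer.BirchSwinnertonDyer.Theorems.StarredOptimalManinUnitFiveSevenReciprocityTowerFromAbove

variable {K₀ : Type} [Field K₀] [CharZero K₀] (W : WeierstrassCurve K₀) [W.IsElliptic]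
  -- the lower field
  (F₀ : Type) [Field F₀] [Algebra K₀ F₀] [ValuativeRel F₀] [TopologicalSpace F₀] [IsNonarchimedeanLocalField F₀] [CharZero F₀]
  {p : ℕ} [Fact p.Prime] [Fact (¬ IsUnit (p : integerC F₀))] [IsAdicComplete (Ideal.span {(p : integerC F₀)}) (integerC F₀)]
  (hp₀ : valuation F₀ p < 1) [Algebra ℚ_[p] F₀] [FiniteDimensional ℚ_[p] F₀]
  (w₀ : Valuation F₀ ℝ≥0) [(W.baseChange F₀).IsIntegral w₀.integer]
  -- the middle field (Galois over `F₀`)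
  (F : Type) [Field F] [Algebra K₀ F] [Algebra F₀ F] [IsScalarTower K₀ F₀ F] [ValuativeRel F] [TopologicalSpace F]
  [IsNonarchimedeanLocalField F] [CharZero F] [Fact (¬ IsUnit (p : integerC F))]
  [IsAdicComplete (Ideal.span {(p : integerC F)}) (integerC F)]
  (hp : valuation F p < 1) [Algebra ℚ_[p] F] [IsScalarTower ℚ_[p] F₀ F] [FiniteDimensional F₀ F] [FiniteDimensional ℚ_[p] F] [IsGalois F₀ F]
  (w : Valuation F ℝ≥0) [w.Compatible] [(W.baseChange F).IsIntegral w.integer]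
  -- the upper field
  (K' : Type) [Field K'] [Algebra K₀ K'] [Algebra F K'] [IsScalarTower K₀ F K'] [ValuativeRel K'] [TopologicalSpace K']
  [IsNonarchimedeanLocalField K'] [CharZero K'] [Fact (¬ IsUnit (p : integerC K'))]
  [IsAdicComplete (Ideal.span {(p : integerC K')}) (integerC K')]
  (hp' : valuation K' p < 1) [Algebra ℚ_[p] K'] [IsScalarTower ℚ_[p] F K'] [FiniteDimensional F K']
  (w' : Valuation K' ℝ≥0) [(W.baseChange K').IsIntegral w'.integer]
  -- the Weil tower
  (e : (k : ℕ) → geomTorsion W ((p ^ k : ℕ) : ℤ) → geomTorsion W ((p ^ k : ℕ) : ℤ) → AlgebraicClosure K₀)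
  (hμ : ∀ k S T, e k S T ^ (p ^ k) = 1) (hadd₁ : ∀ k S₁ S₂ T, e k (S₁ + S₂) T = e k S₁ T * e k S₂ T)
  (hadd₂ : ∀ k S T₁ T₂, e k S (T₁ + T₂) = e k S T₁ * e k S T₂)
  (hgal : ∀ k (σ : absoluteGaloisGroup K₀) (S T : geomTorsion W ((p ^ k : ℕ) : ℤ)), σ • e k S T = e k (σ • S) (σ • T))
  (hcompat : ∀ k (S T : geomTorsion W ((p ^ (k + 1) : ℕ) : ℤ)),
    e k (torsionMulHom W (p ^ (k + 1)) (p ^ k) p (pow_succ p k).symm S)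
      (torsionMulHom W (p ^ (k + 1)) (p ^ k) p (pow_succ p k).symm T) = e (k + 1) S T ^ p)
  -- the intertwiners `V(γ⁻¹)` of the two towers
  {gV : W.rationalTateModule p ≃ₗ[ℚ_[p]] W.rationalTateModule p}
  (hgVdef : ∀ m, gV m = (W.rationalTateGaloisRep p (W.continuous_rationalGaloisRepTate_holds p)) (towerConjElement K₀ F₀ F)⁻¹ m)
  {gV' : W.rationalTateModule p ≃ₗ[ℚ_[p]] W.rationalTateModule p}
  (hgV'def : ∀ m, gV' m = (W.rationalTateGaloisRep p (W.continuous_rationalGaloisRepTate_holds p)) (towerConjElement K₀ F K')⁻¹ m)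

include hgal hgVdef hgV'def in
/-- ★★★ **[REC-tower] at the Galois tower `F₀ ⊆ F` from Kato's formula over a finite extension `K' ⊇ F` with an arbitrary constant.**
The body `∃ c₀ ≠ 0, (lower clause over F₀) ∧ (upper clause over F, all tower cocycles)` of `tatePairingPoint_eq_trace_expStar_log_tower` at
`(W, F₀ ⊆ F, e, d₀, d)`, from: the Prop-1.2.3 binders of `V_pW|_{Γ_{F₀}}|_{Γ_F}` and of `V_pW|_{Γ_F}|_{Γ_{K'}}`; generators `d₀ / F₀`, `d / F` (tower),
`d' / K'` (tower over `F`) with the compatibility clauses `hcomp`, `hcomp'`; `hlog`, `hlog'`; non-degeneracy of `e`; a nonzero additive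
`E(F₀) → ℤ_p`; and Kato's formula over `K'` for the DIRECT representation at `d'.map V(γ'⁻¹)` with ANY constant `c' ∈ K'`. (Descent `K' → F`,
then Galois averaging over `Gal(F/F₀)`.) [cite: Kato1993LNM1553, Ch. II §1.2.4 and Thm. 1.4.1 (4)] [cite: SerreLocalFields1979, XIII §3 Prop. 7] -/
theorem exists_const_tower_clauses_of_formula_above
    (hnondeg : ∀ k (T : geomTorsion W ((p ^ k : ℕ) : ℤ)), (∀ S, e k S T = 1) → T = 0)
    -- binders of the tower representation over `F` (relative to `F₀`)
    (hinj : (bdRPeriodRingData (F := F) (p := p) hp).CupLogInjective (logCyclotomic p)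
      ((restrictedRationalTateRep W F₀ p).restrict (absGaloisRestrict F₀ F)))
    (hde : ∀ z : contOneCocycles ((restrictedRationalTateRep W F₀ p).restrict (absGaloisRestrict F₀ F)).toTopRep,
      (bdRPeriodRingData (F := F) (p := p) hp).HasDualExp (logCyclotomic p)
        ((restrictedRationalTateRep W F₀ p).restrict (absGaloisRestrict F₀ F)) fun σ => z.1 σ)
    -- binders of the tower representation over `K'` (relative to `F`)
    (hinj' : (bdRPeriodRingData (F := K') (p := p) hp').CupLogInjective (logCyclotomic p)
      ((restrictedRationalTateRep W F p).restrict (absGaloisRestrict F K')))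
    (hde' : ∀ z : contOneCocycles ((restrictedRationalTateRep W F p).restrict (absGaloisRestrict F K')).toTopRep,
      (bdRPeriodRingData (F := K') (p := p) hp').HasDualExp (logCyclotomic p)
        ((restrictedRationalTateRep W F p).restrict (absGaloisRestrict F K')) fun σ => z.1 σ)
    -- line data and compatibilities
    (d₀ : (bdRPeriodRingData (F := F₀) (p := p) hp₀).FilZeroLine (restrictedRationalTateRep W F₀ p))
    (d : (bdRPeriodRingData (F := F) (p := p) hp).FilZeroLine ((restrictedRationalTateRep W F₀ p).restrict (absGaloisRestrict F₀ F)))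
    (d' : (bdRPeriodRingData (F := K') (p := p) hp').FilZeroLine ((restrictedRationalTateRep W F p).restrict (absGaloisRestrict F K')))
    (hcomp : ∀ (η₀ : contOneCocycles (restrictedTateRep W F₀ p).toTopRep)
        (η : contOneCocycles ((restrictedTateRep W F₀ p).restrict (absGaloisRestrict F₀ F)).toTopRep),
        (∀ σ, η.1 σ = η₀.1 (absGaloisRestrict F₀ F σ)) →
        expStarCoordTower W hp d η = algebraMap F₀ F (expStarCoord W hp₀ d₀ η₀))
    (hcomp' : ∀ (η : contOneCocycles (restrictedTateRep W F p).toTopRep)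
        (η' : contOneCocycles ((restrictedTateRep W F p).restrict (absGaloisRestrict F K')).toTopRep),
        (∀ σ, η'.1 σ = η.1 (absGaloisRestrict F K' σ)) →
        expStarCoordTower W hp' d' η' =
          algebraMap F K' (expStarCoord W hp
            (d.map gV (ratGalEquiv_intertwines W F₀ (absGaloisRestrict_eq_conj_towerConjElement_inv F₀ F) hgVdef)) η))
    (hlog : ∀ P₀ : (W.baseChange F₀).toAffine.Point,
      FormalGroupChart.padicLogPointFiniteExt w (W.baseChange F) p
          (WeierstrassCurve.Affine.Point.map (IsScalarTower.toAlgHom K₀ F₀ F) P₀) =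
        algebraMap F₀ F (FormalGroupChart.padicLogPointFiniteExt w₀ (W.baseChange F₀) p P₀))
    (hlog' : ∀ P : (W.baseChange F).toAffine.Point,
      FormalGroupChart.padicLogPointFiniteExt w' (W.baseChange K') p
          (WeierstrassCurve.Affine.Point.map (IsScalarTower.toAlgHom K₀ F K') P) =
        algebraMap F K' (FormalGroupChart.padicLogPointFiniteExt w (W.baseChange F) p P))
    -- Kato's formula over `K'`, any constant
    (c' : K')
    (hrec' : ∀ (η'' : contOneCocycles (restrictedTateRep W K' p).toTopRep) (P' : (W.baseChange K').toAffine.Point),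
      ((tatePairingPoint W K' p e hμ hadd₁ hadd₂ hgal hcompat (oneCocycleClass _ η'') P' : ℤ_[p]) : ℚ_[p]) =
        Algebra.trace ℚ_[p] K'
          (c' * expStarCoord W hp'
              (d'.map gV' (ratGalEquiv_intertwines W F (absGaloisRestrict_eq_conj_towerConjElement_inv F K') hgV'def)) η'' *
            FormalGroupChart.padicLogPointFiniteExt w' (W.baseChange K') p P'))
    (hφ : ∃ φ : (W.baseChange F₀).toAffine.Point →+ ℤ_[p], φ ≠ 0) :
    ∃ c₀ : F₀, c₀ ≠ 0 ∧
      (∀ (η₀ : contOneCocycles (restrictedTateRep W F₀ p).toTopRep) (P₀ : (W.baseChange F₀).toAffine.Point),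
        ((tatePairingPoint W F₀ p e hμ hadd₁ hadd₂ hgal hcompat (oneCocycleClass _ η₀) P₀ : ℤ_[p]) : ℚ_[p]) =
          Algebra.trace ℚ_[p] F₀
            (c₀ * expStarCoord W hp₀ d₀ η₀ * FormalGroupChart.padicLogPointFiniteExt w₀ (W.baseChange F₀) p P₀)) ∧
      ∀ (η : contOneCocycles ((restrictedTateRep W F₀ p).restrict (absGaloisRestrict F₀ F)).toTopRep)
        (P : (W.baseChange F).toAffine.Point),
        ((tatePairingPointTower W F₀ e hμ hadd₁ hadd₂ hgal hcompat (oneCocycleClass _ η) P : ℤ_[p]) : ℚ_[p]) =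
          Algebra.trace ℚ_[p] F
            (algebraMap F₀ F c₀ * expStarCoordTower W hp d η * FormalGroupChart.padicLogPointFiniteExt w (W.baseChange F) p P) :=
  -- descent `K' → F`: Kato's formula over `F` for the direct representation at `d.map V(γ⁻¹)` with constant `[K':F]⁻¹ Tr_{K'/F}(c')`
  exists_const_tower_clauses_of_galois W F₀ hp₀ w₀ F hp w e hμ hadd₁ hadd₂ hgal hcompat hgVdef hnondeg hinj hde d₀ d hcomp hlog
    ((Module.finrank F K' : F)⁻¹ * Algebra.trace F K' c')
    (tatePairingPoint_eq_trace_of_direct_towerConj W F hp w K' hp' w' e hμ hadd₁ hadd₂ hgal hcompat hgV'def hinj' hde' _ d' hcomp' hlog'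
      c' hrec')
    hφ

end Summit.BirchSwinnertonDyer.BirchSwinnertonDyer.Theorems.StarredOptimalManinUnitFiveSevenReciprocityTowerFromAbove

end
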